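import Summits.ResolutionOfSingularities.ResolutionOfSingularities.Theorems.FrobeniusLadderFInjectiveMacaulayficationGradedChartClause
import Summits.ResolutionOfSingularities.ResolutionOfSingularities.Theorems.FrobeniusLadderFInjectiveMacaulayficationWeightedConeCore
import HarnessLib

/-!
# G5 `stub_gradedConeFiModel`: THE GRADED ENGINE (crux `FInjectiveMacaulayfication`, §16 line `graded-engine`)

Proof file for the registered stub G5 `stub_gradedConeFiModel` of crux stmt-ResolutionOfSingularities-15315
(`FrobeniusLadder.FInjectiveMacaulayfication`), skeleton v11 `86e9127b`, §16 THE GRADED ENGINE (CRUX-PLAN w45a v3; lead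
seat res-L1-w45a-lead-1). [OURS · L1 W4.5a]

For `f` weighted-homogeneous (weights `w`, `N = c_v·w_v` for every `v`, Veronese saturation of `I_N`), `(f)` prime with
all `x̄_v ≠ 0` and `R = k[X]/(f)` satisfying the clause at the closed points off the origin, the weighted blow-up
`affineBlowup (I_N R)` is an F-injective Macaulayfication of `Spec R` — at EVERY prime `p`, with no hypothesis on
μ-cover charts (contrast §15 `WeightedConeFiModel.stub_weightedConeFiModel`, p465171, which needs the cover charts to be
good along `X_v = 0` and is silent when `p ∣ w_v`). Proof: the landed engine core
`WeightedConeCore.weightedConeFiModel_of_chartClause` (p460946) needs only the chart clause at the maximal ideals of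
each chart `R[I_N R/x̄_v^{c_v}]` containing `x̄_v^{c_v}`, which is G4 `GradedChartClause.stub_gradedChartClause`.
No definitions, no named facts. [folklore]
-/

set_option linter.dupNamespace false

open AlgebraicGeometry CategoryTheory Literature.AlgebraicGeometry.Resolution

namespace Summit.ResolutionOfSingularities.ResolutionOfSingularities.Theorems.FInjectiveMacaulayfication.GradedConeFiModel

open Summit.ResolutionOfSingularities.ResolutionOfSingularities.Theorems.FInjectiveMacaulayfication

/-- G5 **THE GRADED ENGINE** (registered stub `stub_gradedConeFiModel`): `f` weighted-homogeneous prime with all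
`x̄_v ≠ 0`, `N = c_v·w_v` with Veronese saturation, clause off the origin ⇒ `affineBlowup (I_N R)` is an F-injective
Macaulayfication of `Spec R`, at every `p` (engine core p460946 ∘ G4). [folklore] -/
theorem stub_gradedConeFiModel : ∀ (p : ℕ) [Fact p.Prime] (k : Type) [Field k] [CharP k p] (n : ℕ) (w : Fin n → ℕ) (N D : ℕ)
    (c : Fin n → ℕ), 0 < N → (∀ v : Fin n, 0 < w v ∧ c v * w v = N) →
    (∀ (K : ℕ) (b : Fin n →₀ ℕ), K * N ≤ Finsupp.weight w b → (MvPolynomial.monomial b (1 : k) : MvPolynomial (Fin n) k) ∈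
      (Ideal.span {m : MvPolynomial (Fin n) k | ∃ b : Fin n →₀ ℕ, N ≤ Finsupp.weight w b ∧ m = MvPolynomial.monomial b 1}) ^ K) →
    ∀ (f : MvPolynomial (Fin n) k), MvPolynomial.IsWeightedHomogeneous w f D → (Ideal.span {f}).IsPrime →
    (∀ v : Fin n, Ideal.Quotient.mk (Ideal.span {f}) (MvPolynomial.X v) ≠ 0) →
    (∀ (Q : Ideal (MvPolynomial (Fin n) k ⧸ Ideal.span {f})) [Q.IsMaximal],
      (∃ j : Fin n, Ideal.Quotient.mk (Ideal.span {f}) (MvPolynomial.X j) ∉ Q) →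
      ∀ d : ℕ, ringKrullDim (Localization.AtPrime Q) = d → ∀ s : Fin d → Localization.AtPrime Q,
        (Ideal.span (Set.range s)).radical.IsMaximal →
          RingTheory.Sequence.IsWeaklyRegular (Localization.AtPrime Q) (List.ofFn s) ∧
          ∀ y : Localization.AtPrime Q, (∃ e : ℕ, y ^ p ^ e ∈ Ideal.span
            ((fun z : Localization.AtPrime Q => z ^ p ^ e) ''
              (Ideal.span (Set.range s) : Set (Localization.AtPrime Q)))) → y ∈ Ideal.span (Set.range s)) →
    ∃ (X' : Scheme.{0}) (π : X' ⟶ Spec (.of (MvPolynomial (Fin n) k ⧸ Ideal.span {f}))), IsProper π ∧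
      Literature.AlgebraicGeometry.Resolution.IsBirational π ∧
      ∀ y : X', IsDomain (X'.presheaf.stalk y) ∧ ∀ d : ℕ, ringKrullDim (X'.presheaf.stalk y) = d →
        ∀ s : Fin d → X'.presheaf.stalk y, (Ideal.span (Set.range s)).radical.IsMaximal →
          RingTheory.Sequence.IsWeaklyRegular (X'.presheaf.stalk y) (List.ofFn s) ∧
          ∀ z : X'.presheaf.stalk y, (∃ e : ℕ, z ^ p ^ e ∈
              Ideal.span ((fun w : X'.presheaf.stalk y => w ^ p ^ e) ''
                (Ideal.span (Set.range s) : Set (X'.presheaf.stalk y)))) →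
            z ∈ Ideal.span (Set.range s) := by
  intro p _ k _ _ n w N D c hN hwc hpow f hf hfprime hXne hoff
  have hc : ∀ j : Fin n, 0 < c j := fun j => Nat.pos_of_ne_zero fun h => by
    have h2 := (hwc j).2
    rw [h, zero_mul] at h2
    omega
  exact WeightedConeCore.weightedConeFiModel_of_chartClause p k n w N c hN hwc hpow f hfprime hXne hoff
    (fun v Q _ hQ => GradedChartClause.stub_gradedChartClause p k n w v (hwc v).1 N (c v) D (hwc v).2 (hc v) hpow f hf
      hfprime hXne hoff Q hQ)

end Summit.ResolutionOfSingularities.ResolutionOfSingularities.Theorems.FInjectiveMacaulayfication.GradedConeFiModel
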